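import Summits.ValiantsHypothesis.ValiantsHypothesis.Theses.RealTau
import Literature.Computability.AlgebraicComplexity.RealTauKnownCases

/-!
# Crux `RealTau.RealTauRefined` (stmt-ValiantsHypothesis-18101), line `fischer-powers` —
# the `K`-free Descartes bound for Waring sums on a monomial curve (calibration stub)

For ANY number `K` of powers, a nonzero `G = Σ_{i<K} ε_i (Σ_{l<T} c_il X^(e_l))^m` has at most
`2·C(T+m-1, m)` distinct real zeros: every `h_i^m` is supported on the same set of exponents
`{Σ_{l ∈ k} e_l : k a multiset of size m from Fin T}` (multinomial theorem, Mathlib `Finset.sum_pow`),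
of cardinality `≤ #Sym (Fin T) m = C(T+m-1, m)` (stars and bars, `Sym.card_sym_eq_choose`), and a
nonzero polynomial with `s` monomials has `≤ 2(s-1)+1` distinct real zeros (Descartes, tree
`card_roots_toFinset_le_of_card_support`).  Consequently the open core of the line lives exactly in
the regime `K ≥ 3`, `m ≥ 3`, `T ≥ m + 2` (elsewhere `C(T+m-1,m) ≤ 4^m` or `≤ (T+1)^2`).
-/

noncomputable section

-- single-conjunct layout: Sub = Summit, duplicated namespace component intended
set_option linter.dupNamespace false

namespace Summit.ValiantsHypothesis.ValiantsHypothesis.Theorems.RealTauRealTauRefined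

open Polynomial Finset
open Literature.Computability.AlgebraicComplexity

/-- A product of terms `C (d l) * X^(e l)` over a multiset of indices is the single term
`C (∏ d) * X^(Σ e)`. [folklore] -/
theorem multiset_prod_map_C_mul_X_pow {T : ℕ} (d : Fin T → ℝ) (e : Fin T → ℕ)
    (s : Multiset (Fin T)) :
    (s.map fun l => C (d l) * X ^ (e l)).prod = C ((s.map d).prod) * X ^ ((s.map e).sum) := by
  induction s using Multiset.induction_on with
  | empty => simp
  | cons a s ih =>
    rw [Multiset.map_cons, Multiset.prod_cons, ih, Multiset.map_cons, Multiset.prod_cons,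
      Multiset.map_cons, Multiset.sum_cons, C_mul, pow_add]
    ring

/-- **Multinomial support.** The `m`-th power of a linear form in the monomials `X^(e_l)` is
supported on the exponents `Σ_{l ∈ k} e_l`, `k` ranging over the size-`m` multisets of indices.
[folklore; multinomial theorem] -/
theorem support_linForm_pow_subset {T : ℕ} (d : Fin T → ℝ) (e : Fin T → ℕ) (m : ℕ) :
    ((∑ l, C (d l) * X ^ (e l)) ^ m).support ⊆
      ((univ : Finset (Fin T)).sym m).image (fun k => (k.val.map e).sum) := by
  classical
  intro n hn
  rw [Finset.sum_pow] at hn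
  by_contra hnot
  refine (Polynomial.mem_support_iff.mp hn) ?_
  rw [finsetSum_coeff]
  refine Finset.sum_eq_zero fun k hk => ?_
  have hterm : ((k.val.countPerms : ℝ[X]) * (k.val.map fun l => C (d l) * X ^ (e l)).prod) =
      C ((k.val.countPerms : ℝ) * (k.val.map d).prod) * X ^ ((k.val.map e).sum) := by
    rw [multiset_prod_map_C_mul_X_pow, ← mul_assoc, ← C_eq_natCast, ← C_mul]
  rw [hterm, coeff_C_mul_X_pow, if_neg]
  intro hns
  exact hnot (Finset.mem_image.mpr ⟨k, hk, hns.symm⟩)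

/-- **`K`-free monomial count of a Waring sum on a monomial curve**: `Σ_{i<K} ε_i (Σ_l c_il X^(e_l))^m`
has at most `C(T+m-1, m)` monomials, for every `K`. [folklore; stars and bars] -/
theorem card_support_waring_le {K m T : ℕ} (ε : Fin K → ℝ) (c : Fin K → Fin T → ℝ)
    (e : Fin T → ℕ) :
    (∑ i, C (ε i) * (∑ l, C (c i l) * X ^ (e l)) ^ m).support.card ≤ Nat.choose (T + m - 1) m := by
  classical
  set S : Finset ℕ := ((univ : Finset (Fin T)).sym m).image (fun k => (k.val.map e).sum) with hS
  have hsub : (∑ i, C (ε i) * (∑ l, C (c i l) * X ^ (e l)) ^ m).support ⊆ S := by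
    intro n hn
    by_contra hnot
    refine (Polynomial.mem_support_iff.mp hn) ?_
    rw [finsetSum_coeff]
    refine Finset.sum_eq_zero fun i _ => ?_
    rw [coeff_C_mul]
    have : ((∑ l, C (c i l) * X ^ (e l)) ^ m).coeff n = 0 :=
      Polynomial.notMem_support_iff.mp fun h => hnot (support_linForm_pow_subset (c i) e m h)
    rw [this, mul_zero]
  have hcardS : S.card ≤ Nat.choose (T + m - 1) m :=
    calc S.card ≤ ((univ : Finset (Fin T)).sym m).card := Finset.card_image_le
      _ = Fintype.card (Sym (Fin T) m) := by rw [Finset.sym_univ, Finset.card_univ]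
      _ = Nat.choose (T + m - 1) m := by rw [Sym.card_sym_eq_choose, Fintype.card_fin]
  exact (Finset.card_le_card hsub).trans hcardS

/-- **Registered stub `stub_waringDescartes` of line `fischer-powers` (the `K`-free Descartes
bound).**  For every `K`, signs `ε_i = ±1`, real coefficients `c : K × T` and exponents `e`, the
polynomial `G = Σ_{i<K} ε_i (Σ_l c_il X^(e_l))^m`, if nonzero, has at most `2·C(T+m-1, m)` distinct
real zeros (monomial count `≤ C(T+m-1,m)` by the multinomial theorem and stars and bars, then
Descartes' rule).  This settles the regimes `T ≤ m+1` (`C(2m,m) ≤ 4^m`) and `m ≤ 2` (`≤ (T+1)^2`)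
of `WaringOnCurve` with `a = 3`; the open core is `K ≥ 3`, `m ≥ 3`, `T ≥ m+2`.
[folklore; cf. Koiran2011 §6 (bound 2kt^m − 1), Tavenas2014 Conj. 3.24] -/
theorem stub_waringDescartes :
    ∀ (K m T : ℕ) (ε : Fin K → ℤˣ) (c : Fin K → Fin T → ℝ) (e : Fin T → ℕ), StrictMono e →
      (∑ i, C (((ε i : ℤ) : ℝ)) * (∑ l, C (c i l) * X ^ (e l)) ^ m) ≠ 0 →
        (∑ i, C (((ε i : ℤ) : ℝ)) * (∑ l, C (c i l) * X ^ (e l)) ^ m).roots.toFinset.card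
          ≤ 2 * Nat.choose (T + m - 1) m := by
  intro K m T ε c e _he hG
  have h1 := card_roots_toFinset_le_of_card_support hG
  have h2 := card_support_waring_le (fun i => (((ε i : ℤ) : ℝ))) c e (m := m)
  have h3 : 0 < (∑ i, C (((ε i : ℤ) : ℝ)) * (∑ l, C (c i l) * X ^ (e l)) ^ m).support.card :=
    card_pos.mpr (nonempty_iff_ne_empty.mpr (mt support_eq_empty.mp hG))
  omega

end Summit.ValiantsHypothesis.ValiantsHypothesis.Theorems.RealTauRealTauRefined
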